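import Literature.Analysis.FluidPDE.AxisymNoSwirlImpulseSlice
import HarnessLib

/-!
# Axisymmetric flows without swirl: the WEIGHTED co-signed flux — slice inequality
# `∫ r²g β'(η) ∂ₜη ≤ ∫ β(η) D(r²g)[u] + ν ∫ β(η) div(r²∇g)` for convex `β`
# (weighted form of Gallay–Šverák 2015, Lemma 5.1 / Lemma 6.4)

Analysis/FluidPDE proof file (theorems only; no definitions, no named facts).

Gallay–Šverák (*Remarks on the Cauchy problem for the axisymmetric Navier–Stokes equations*,
Confluentes Math. 7 (2015) 67–92 = arXiv:1510.01036) record for the swirl-free quotient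
`η = ω_θ/r`, `∂ₜη + u·∇η = Δη + (2/r)∂ᵣη` ((2.9)), two monotone structures: `∫ β(η) dx` is
non-increasing for every convex `β` (Lemma 5.1 and its signed refinement, the tree's
`AxisymNoSwirlCoSignedFlux`), and the impulse `∫ r²η dx` is conserved (Lemma 6.4; tree
`AxisymNoSwirlImpulseConservation`, `AxisymNoSwirlImpulseSlice`). This file proves the slice
computation behind their COMBINATION — the `r²`-moments of the positive and negative parts of
`η` separately ("weighted co-signed flux"), which is what controls the enstrophy
`∫ |ω|² = ∫ r²η²  ≤ ‖η‖_∞ ∫ r²|η|` of SIGNED swirl-free data (e.g. a vortex ring plus a dilute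
counter-rotating shell, the Schwartz-class substitute for a pure ring):

* `integral_weight_mul_deriv_comp_mul_le_of_drift_laplacian` — **the fixed-time inequality.**
  For `β ∈ C²` with `β(0) = β'(0) = 0`, `0 ≤ β'' ≤ K`; an axisymmetric scalar `G ∈ C²` with
  `G, ∂ᵢG, ∂ᵢ∂ᵢG, radDerivQuot G ∈ L²`; a divergence-free `b ∈ C¹` bounded with bounded
  derivative; `ν ≥ 0`; the equation `G' + DG[b] = ν(ΔG + 2 radDerivQuot G)`; and a weight
  `g ∈ C²`, `g ≥ 0`, with `r²g`, `x₀g`, `x₁g`, `r²∂ᵢg`, `div(r²∇g)` BOUNDED: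
  `∫ r²g β'(G) G' ≤ ∫ β(G) D(r²g)[b] + ν ∫ β(G) div(r²∇g)`.
  (Transport: `∫ r²g β'(G) DG[b] = ∫ r²g D(β∘G)[b] = −∫ β(G) D(r²g)[b]` since `div b = 0`.
  Diffusion: `r²(ΔG + 2∂ᵣG/r) = div(r²∇G)` (tree, `cylRadius_sq_mul_laplacian_add_eq_divergence`),
  so `∫ gβ'(G) div(r²∇G) = −∫ β'(G) r²⟪∇g, ∇G⟫ − ∫ g β''(G) r²|∇G|² ≤ −∫ r²⟪∇g, ∇(β∘G)⟫
  = ∫ β(G) div(r²∇g)` — two whole-space integrations by parts, no axis term.)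
* `IsTaoSolutionOn.integral_weight_mul_deriv_comp_mul_angVortQuot_deriv_le` — the same along a
  Tao-class solution (`IsTaoSolutionOn T ν u₀ v q`, `0 < ν`, `0 < T`) from an axisymmetric
  swirl-free datum, with `G = Ω(t) = angVortQuot (v t)`, `G' = angVortQuot (∂ₜv t)`, `b = v t`
  (all `L²` data from `IsTaoSolutionOn.memLp_angVortQuot_data`, the `Ω`-equation
  `IsClassicalNSSolutionOn.angVortQuot_eq` without swirl).

With the bounded weights `g_ε = (1 + ε|x|²)⁻²` (`ε → 0`) and the convex approximants
`β_δ ↑ (·)^±` of `AxisymNoSwirlCoSignedFlux` this is the slice input of the weighted co-signed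
balance `∫ r²η^±(t) ≤ ∫ r²η^±(0) + ∫₀ᵗ∫ 2(x₀u₀ + x₁u₁) η^±` (sequel file). WHAT THIS IS NOT: not
a statement about blow-up — an a-priori inequality for smooth swirl-free axisymmetric flows.

## Mathlib / tree search

Tree (used): `cylRadius_sq_mul_laplacian_add_eq_divergence`, `hasFDerivAt_cylRadius_sq`
(`AxisymNoSwirlImpulseSlice`, `AxisymmetricVorticityTransport`),
`integral_mul_fderiv_apply_eq_neg_of_isDivFree'` (`AxisymTransportIBP`),
`integral_mul_divergence_add_eq_zero_of_integrable` (`WholeSpaceIBPIntegrable`),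
`IsTaoSolutionOn.memLp_angVortQuot_data`, `…exists_lintegral_sq_quot_le`, `…exists_bound_velocity`,
`…exists_bound_fderiv_velocity`, `IsClassicalNSSolutionOn.angVortQuot_eq`,
`Icc_subset_closure_interior_Icc'`. The unweighted twin is
`integral_deriv_comp_mul_le_of_drift_laplacian` (`AxisymNoSwirlCoSignedFlux`); the linear weighted
twin (`β = id`) is `IsTaoSolutionOn.integral_weight_mul_angVortQuot_deriv_eq`
(`AxisymNoSwirlImpulseSlice`). `lean search 'weight.*deriv_comp|WeightedCoSigned'`: nothing before
this file. Private copies of the small convex-function lemmas of `AxisymNoSwirlCoSignedFlux`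
(which are private there) are included.

## References

* Th. Gallay, V. Šverák, Confluentes Math. 7 (2015) 67–92 = arXiv:1510.01036, §5 Lemma 5.1,
  §6 Lemma 6.4, §2 (2.9). [GallaySverak2016]
-/

noncomputable section

open MeasureTheory Set Function Filter InnerProductSpace
open _root_.Topology
open scoped NNReal ENNReal RealInnerProductSpace Laplacian ContDiff

namespace Literature.Analysis.FluidPDE

/-! ### Convex `C²` functions with `β(0) = β'(0) = 0`, `0 ≤ β'' ≤ K` (private copies) -/

section Convex

variable {β : ℝ → ℝ} {K : ℝ}

/-- For `β ∈ C²`: `β` and `β'` are differentiable. [folklore] -/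
private theorem differentiable_deriv_of_contDiff_two' (hβ : ContDiff ℝ 2 β) :
    Differentiable ℝ β ∧ Differentiable ℝ (deriv β) := by
  refine ⟨hβ.differentiable (by norm_num), ?_⟩
  have h1 : ContDiff ℝ 1 (deriv β) := ContDiff.deriv' (n := 1) (by exact_mod_cast hβ)
  exact h1.differentiable one_ne_zero

/-- For `β ∈ C²`: `β' ∈ C¹`. [folklore] -/
private theorem contDiff_one_deriv_of_contDiff_two' (hβ : ContDiff ℝ 2 β) :
    ContDiff ℝ 1 (deriv β) :=
  ContDiff.deriv' (n := 1) (by exact_mod_cast hβ)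

/-- For `β ∈ C²`, `β''` is continuous. [folklore] -/
private theorem continuous_deriv_deriv_of_contDiff_two' (hβ : ContDiff ℝ 2 β) :
    Continuous (deriv (deriv β)) :=
  (contDiff_one_deriv_of_contDiff_two' hβ).continuous_deriv le_rfl

/-- If `β'(0) = 0` and `|β''| ≤ K` then `|β'(v)| ≤ K |v|`. [folklore] -/
private theorem abs_deriv_le_mul_abs' (hβ : ContDiff ℝ 2 β) (h0 : deriv β 0 = 0)
    (hK : ∀ v, |deriv (deriv β) v| ≤ K) (v : ℝ) : |deriv β v| ≤ K * |v| := by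
  obtain ⟨-, hd'⟩ := differentiable_deriv_of_contDiff_two' hβ
  have h := Convex.norm_image_sub_le_of_norm_deriv_le (f := deriv β) (s := univ) (x := 0) (y := v)
    (fun x _ => hd' x) (fun x _ => by rw [Real.norm_eq_abs]; exact hK x) convex_univ (mem_univ _)
    (mem_univ _)
  rw [h0, sub_zero, sub_zero, Real.norm_eq_abs, Real.norm_eq_abs] at h
  exact h

/-- If `β(0) = β'(0) = 0` and `|β''| ≤ K` then `|β(v)| ≤ K v²`. [folklore] -/
private theorem abs_le_mul_sq' (hβ : ContDiff ℝ 2 β) (h00 : β 0 = 0) (h0 : deriv β 0 = 0)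
    (hK : ∀ v, |deriv (deriv β) v| ≤ K) (v : ℝ) : |β v| ≤ K * v ^ 2 := by
  obtain ⟨hd, -⟩ := differentiable_deriv_of_contDiff_two' hβ
  have hK0 : 0 ≤ K := (abs_nonneg _).trans (hK 0)
  have hseg : ∀ x ∈ uIcc 0 v, ‖deriv β x‖ ≤ K * |v| := by
    intro x hx
    rw [Real.norm_eq_abs]
    refine (abs_deriv_le_mul_abs' hβ h0 hK x).trans (mul_le_mul_of_nonneg_left ?_ hK0)
    rcases le_total 0 v with hv | hv
    · rw [uIcc_of_le hv] at hx
      rw [abs_of_nonneg hx.1, abs_of_nonneg hv]; exact hx.2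
    · rw [uIcc_of_ge hv] at hx
      rw [abs_of_nonpos hx.2, abs_of_nonpos hv]; linarith [hx.1]
  have h := Convex.norm_image_sub_le_of_norm_deriv_le (f := β) (s := uIcc 0 v) (x := 0) (y := v)
    (fun x _ => hd x) hseg (convex_uIcc 0 v) left_mem_uIcc right_mem_uIcc
  rw [h00, sub_zero, sub_zero, Real.norm_eq_abs, Real.norm_eq_abs] at h
  calc |β v| ≤ K * |v| * |v| := h
    _ = K * v ^ 2 := by rw [mul_assoc, abs_mul_abs_self, sq]

/-- Chain rule: `D(β ∘ G)(x) w = β'(G x) · DG(x) w`. [folklore] -/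
private theorem fderiv_comp_deriv_apply' {G : EuclideanSpace ℝ (Fin 3) → ℝ} (hβ : Differentiable ℝ β)
    (hG : Differentiable ℝ G) (x w : EuclideanSpace ℝ (Fin 3)) :
    fderiv ℝ (fun y => β (G y)) x w = deriv β (G x) * fderiv ℝ G x w := by
  have h := ((hβ (G x)).hasDerivAt.comp_hasFDerivAt x (hG x).hasFDerivAt)
  rw [show (fun y => β (G y)) = β ∘ G from rfl, h.fderiv]
  simp [smul_eq_mul]

/-- `β'(G) ∈ L²` when `|β'(v)| ≤ K|v|` and `G ∈ L²` is continuous. [folklore] -/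
private theorem memLp_deriv_comp' {G : EuclideanSpace ℝ (Fin 3) → ℝ} (hβ : ContDiff ℝ 2 β)
    (h0 : deriv β 0 = 0) (hK : ∀ v, |deriv (deriv β) v| ≤ K) (hGc : Continuous G)
    (hG : MemLp G 2 volume) : MemLp (fun x => deriv β (G x)) 2 volume := by
  obtain ⟨-, hd'⟩ := differentiable_deriv_of_contDiff_two' hβ
  refine MemLp.of_le_mul (c := K) hG (hd'.continuous.comp hGc).aestronglyMeasurable
    (Eventually.of_forall fun x => ?_)
  rw [Real.norm_eq_abs, Real.norm_eq_abs]
  exact abs_deriv_le_mul_abs' hβ h0 hK (G x)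

/-- `β(G) ∈ L¹` when `|β(v)| ≤ K v²` and `G ∈ L²` is continuous. [folklore] -/
private theorem integrable_comp' {G : EuclideanSpace ℝ (Fin 3) → ℝ} (hβ : ContDiff ℝ 2 β)
    (h00 : β 0 = 0) (h0 : deriv β 0 = 0) (hK : ∀ v, |deriv (deriv β) v| ≤ K) (hGc : Continuous G)
    (hG : MemLp G 2 volume) : Integrable (fun x => β (G x)) := by
  obtain ⟨hd, -⟩ := differentiable_deriv_of_contDiff_two' hβ
  refine (hG.integrable_sq.const_mul K).mono' (hd.continuous.comp hGc).aestronglyMeasurable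
    (Eventually.of_forall fun x => ?_)
  rw [Real.norm_eq_abs]
  exact abs_le_mul_sq' hβ h00 h0 hK (G x)

end Convex

/-! ### Small vector calculus on `ℝ³` (private copies) -/

section Calculus

/-- The coordinates of the gradient are the partial derivatives. [folklore] -/
private theorem gradient_apply_eq_fderiv_single₃' {S : EuclideanSpace ℝ (Fin 3) → ℝ}
    (x : EuclideanSpace ℝ (Fin 3)) (i : Fin 3) :
    gradient S x i = fderiv ℝ S x (EuclideanSpace.single i 1) := by
  have h1 : fderiv ℝ S x (EuclideanSpace.single i 1) =
      ⟪gradient S x, EuclideanSpace.single i (1 : ℝ)⟫ := by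
    rw [gradient, InnerProductSpace.toDual_symm_apply]
  rw [h1, EuclideanSpace.inner_single_right]
  simp

/-- The real inner product on `ℝ³` in coordinates. [folklore] -/
private theorem inner_eq_sum₃' (a b : EuclideanSpace ℝ (Fin 3)) :
    ⟪a, b⟫ = a 0 * b 0 + a 1 * b 1 + a 2 * b 2 := by
  simp only [PiLp.inner_apply, Fin.sum_univ_three, RCLike.inner_apply, conj_trivial]
  ring

/-- `‖w‖ ≤ |w₀| + |w₁| + |w₂|` on `ℝ³`. [folklore] -/
private theorem norm_le_abs_add' (w : EuclideanSpace ℝ (Fin 3)) : ‖w‖ ≤ |w 0| + |w 1| + |w 2| := by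
  have h : ‖w‖ ^ 2 = w 0 ^ 2 + w 1 ^ 2 + w 2 ^ 2 := by
    rw [EuclideanSpace.norm_sq_eq, Fin.sum_univ_three]
    simp only [Real.norm_eq_abs, sq_abs]
  have hs : ‖w‖ ^ 2 ≤ (|w 0| + |w 1| + |w 2|) ^ 2 := by
    rw [h]
    nlinarith [abs_nonneg (w 0), abs_nonneg (w 1), abs_nonneg (w 2), sq_abs (w 0), sq_abs (w 1),
      sq_abs (w 2)]
  exact (pow_le_pow_iff_left₀ (norm_nonneg w) (by positivity) two_ne_zero).1 hs

/-- A linear functional on `ℝ³` applied to a vector, in coordinates. [folklore] -/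
private theorem clm_apply_eq_sum₃ (L : EuclideanSpace ℝ (Fin 3) →L[ℝ] ℝ) (w : EuclideanSpace ℝ (Fin 3)) :
    L w = w 0 * L (EuclideanSpace.single 0 1) + w 1 * L (EuclideanSpace.single 1 1) +
      w 2 * L (EuclideanSpace.single 2 1) := by
  have hw : w = (w 0) • EuclideanSpace.single 0 (1 : ℝ) + (w 1) • EuclideanSpace.single 1 (1 : ℝ) +
      (w 2) • EuclideanSpace.single 2 (1 : ℝ) := by
    ext i
    fin_cases i <;> simp
  conv_lhs => rw [hw]
  rw [map_add, map_add, map_smul, map_smul, map_smul, smul_eq_mul, smul_eq_mul, smul_eq_mul]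

/-- Product rule for the weight `φ = r² g`: `Dφ(x)[w] = 2(x₀w₀ + x₁w₁) g(x) + r² Dg(x)[w]`. [folklore] -/
private theorem fderiv_cylRadius_sq_mul_apply' {g : EuclideanSpace ℝ (Fin 3) → ℝ}
    (hg : Differentiable ℝ g) (x w : EuclideanSpace ℝ (Fin 3)) :
    fderiv ℝ (fun y => cylRadius y ^ 2 * g y) x w =
      2 * (x 0 * w 0 + x 1 * w 1) * g x + cylRadius x ^ 2 * fderiv ℝ g x w := by
  have hθ : HasFDerivAt (fun y : EuclideanSpace ℝ (Fin 3) => cylRadius y ^ 2)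
      ((2 * x 0) • (EuclideanSpace.proj (0 : Fin 3) : EuclideanSpace ℝ (Fin 3) →L[ℝ] ℝ) +
        (2 * x 1) • (EuclideanSpace.proj (1 : Fin 3) : EuclideanSpace ℝ (Fin 3) →L[ℝ] ℝ)) x :=
    hasFDerivAt_cylRadius_sq x
  rw [fderiv_fun_mul hθ.differentiableAt (hg x), hθ.fderiv]
  simp only [_root_.add_apply, _root_.smul_apply, smul_eq_mul]
  have hp : ∀ i : Fin 3, (EuclideanSpace.proj i : EuclideanSpace ℝ (Fin 3) →L[ℝ] ℝ) w = w i :=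
    fun i => rfl
  rw [hp 0, hp 1]
  ring

end Calculus

/-! ### The fixed-time inequality for a convex functional against the weight `r² g` -/

section Slice

variable {G G' : EuclideanSpace ℝ (Fin 3) → ℝ}
  {b : EuclideanSpace ℝ (Fin 3) → EuclideanSpace ℝ (Fin 3)} {ν K : ℝ} {β : ℝ → ℝ}
  {g : EuclideanSpace ℝ (Fin 3) → ℝ} {Cg : ℝ}

/-- **The weighted fixed-time inequality for a convex functional** (the computation of
Gallay–Šverák 2015, Lemma 5.1, against the weight `r²g` of Lemma 6.4). Let `β ∈ C²` with
`β(0) = β'(0) = 0`, `0 ≤ β'' ≤ K`; `G ∈ C²` an axisymmetric scalar with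
`G, ∂ᵢG, ∂ᵢ∂ᵢG, radDerivQuot G ∈ L²`; `b ∈ C¹` divergence free, bounded with
bounded derivative; `ν ≥ 0`; pointwise `G' + DG[b] = ν(ΔG + 2 radDerivQuot G)`; and `g ∈ C²`,
`g ≥ 0`, with `|r²g|, |x₀g|, |x₁g|, |r²∂ᵢg|, |div(r²∇g)| ≤ C_g`. Then
`∫ r²g β'(G) G' ≤ ∫ β(G) D(r²g)[b] + ν ∫ β(G) div(r²∇g)`.
[cite: GallaySverak2016, §5 Lemma 5.1 proof and §6 Lemma 6.4 proof (arXiv pp. 16, 19)] -/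
theorem integral_weight_mul_deriv_comp_mul_le_of_drift_laplacian (hβ : ContDiff ℝ 2 β)
    (h00 : β 0 = 0) (h0 : deriv β 0 = 0) (hnn : ∀ w, 0 ≤ deriv (deriv β) w)
    (hK : ∀ w, |deriv (deriv β) w| ≤ K)
    (hG : ContDiff ℝ 2 G) (hax : IsAxisymmetricScalar G) (hν : 0 ≤ ν) (hL2 : MemLp G 2 volume)
    (h1 : ∀ i : Fin 3, MemLp (fun x => fderiv ℝ G x (EuclideanSpace.single i 1)) 2 volume)
    (h2 : ∀ i : Fin 3, MemLp (fun x => fderiv ℝ (fun y => fderiv ℝ G y (EuclideanSpace.single i 1)) x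
      (EuclideanSpace.single i 1)) 2 volume)
    (hq : MemLp (radDerivQuot G) 2 volume)
    (hb : ContDiff ℝ 1 b) (hdiv : VectorCalculus.IsDivFree b)
    {B : ℝ} (hbB : ∀ x, ‖b x‖ ≤ B) {B' : ℝ} (hDb : ∀ x, ‖fderiv ℝ b x‖ ≤ B')
    (heq : ∀ x, G' x + fderiv ℝ G x (b x) = ν * ((Δ G) x + 2 * radDerivQuot G x))
    (hg : ContDiff ℝ 2 g) (hg0 : ∀ x, 0 ≤ g x)
    (hgr : ∀ x, |cylRadius x ^ 2 * g x| ≤ Cg)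
    (hgx0 : ∀ x, |x 0 * g x| ≤ Cg) (hgx1 : ∀ x, |x 1 * g x| ≤ Cg)
    (hgD : ∀ (i : Fin 3) x, |cylRadius x ^ 2 * fderiv ℝ g x (EuclideanSpace.single i 1)| ≤ Cg)
    (hgdiv : ∀ x, |VectorCalculus.divergence (fun y => (cylRadius y ^ 2) • gradient g y) x| ≤ Cg) :
    ∫ x, cylRadius x ^ 2 * g x * deriv β (G x) * G' x ≤
      (∫ x, β (G x) * fderiv ℝ (fun y => cylRadius y ^ 2 * g y) x (b x)) +
      ν * ∫ x, β (G x) * VectorCalculus.divergence (fun y => (cylRadius y ^ 2) • gradient g y) x := by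
  obtain ⟨hd, hd'⟩ := differentiable_deriv_of_contDiff_two' hβ
  have hβ'1 : ContDiff ℝ 1 (deriv β) := contDiff_one_deriv_of_contDiff_two' hβ
  have hβ1 : ContDiff ℝ 1 β := hβ.of_le (by norm_num)
  have hG1 : ContDiff ℝ 1 G := hG.of_le (by norm_num)
  have hGd : Differentiable ℝ G := hG1.differentiable one_ne_zero
  have hg1 : ContDiff ℝ 1 g := hg.of_le (by norm_num)
  have hgd : Differentiable ℝ g := hg1.differentiable one_ne_zero
  have hK0 : 0 ≤ K := (abs_nonneg _).trans (hK 0)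
  have hCg : 0 ≤ Cg := (abs_nonneg _).trans (hgr 0)
  -- composites
  have hβG : ContDiff ℝ 1 fun y => β (G y) := hβ1.comp hG1
  have hβ'G : ContDiff ℝ 1 fun y => deriv β (G y) := hβ'1.comp hG1
  have hβ'L2 : MemLp (fun x => deriv β (G x)) 2 volume := memLp_deriv_comp' hβ h0 hK hG.continuous hL2
  have hβL1 : Integrable fun x => β (G x) := integrable_comp' hβ h00 h0 hK hG.continuous hL2
  have hchain : ∀ x w, fderiv ℝ (fun y => β (G y)) x w = deriv β (G x) * fderiv ℝ G x w :=
    fun x w => fderiv_comp_deriv_apply' hd hGd x w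
  have hchain' : ∀ x w, fderiv ℝ (fun y => deriv β (G y)) x w =
      deriv (deriv β) (G x) * fderiv ℝ G x w := fun x w => fderiv_comp_deriv_apply' hd' hGd x w
  -- the weight `φ = r² g` and its derivative
  set φ : EuclideanSpace ℝ (Fin 3) → ℝ := fun x => cylRadius x ^ 2 * g x with hφdef
  have hr2 : ContDiff ℝ 1 fun y : EuclideanSpace ℝ (Fin 3) => cylRadius y ^ 2 := by
    have : (fun y : EuclideanSpace ℝ (Fin 3) => cylRadius y ^ 2) = fun y => y 0 ^ 2 + y 1 ^ 2 :=
      funext cylRadius_sq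
    rw [this]; fun_prop
  have hφ1 : ContDiff ℝ 1 φ := hr2.mul hg1
  have hφc : Continuous φ := hφ1.continuous
  have hφb : ∀ x, |φ x| ≤ Cg := hgr
  -- (T) transport: `∫ φ β'(G) DG[b] = -∫ Dφ[b] β(G)`
  have hT' : ∫ x, φ x * fderiv ℝ (fun y => β (G y)) x (b x) =
      -∫ x, fderiv ℝ φ x (b x) * β (G x) := by
    refine integral_mul_fderiv_apply_eq_neg_of_isDivFree' hφ1 hβG hb hdiv hbB hDb ?_ (fun i => ?_)
      (fun i => ?_)
    · -- `φ β(G) ∈ L¹`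
      exact hβL1.bdd_mul hφc.aestronglyMeasurable (ae_of_all _ fun x => by
        rw [Real.norm_eq_abs]; exact hφb x)
    · -- `∂ᵢφ β(G) ∈ L¹` (`∂ᵢφ` bounded)
      have hDφi : ∀ x, |fderiv ℝ φ x (EuclideanSpace.single i 1)| ≤ 2 * Cg + Cg := by
        intro x
        rw [hφdef, fderiv_cylRadius_sq_mul_apply' hgd]
        have hA : |2 * (x 0 * (EuclideanSpace.single i (1 : ℝ) : EuclideanSpace ℝ (Fin 3)) 0 +
            x 1 * (EuclideanSpace.single i (1 : ℝ) : EuclideanSpace ℝ (Fin 3)) 1) * g x| ≤ 2 * Cg := by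
          fin_cases i
          · simp only [Fin.zero_eta, Fin.isValue, PiLp.single_apply, ↓reduceIte,
              mul_one, one_ne_zero, mul_zero, add_zero]
            rw [show 2 * x 0 * g x = 2 * (x 0 * g x) by ring, abs_mul, abs_two]
            linarith [hgx0 x]
          · simp only [Fin.mk_one, Fin.isValue, PiLp.single_apply, zero_ne_one,
              ↓reduceIte, mul_zero, mul_one, zero_add]
            rw [show 2 * x 1 * g x = 2 * (x 1 * g x) by ring, abs_mul, abs_two]
            linarith [hgx1 x]
          · simp only [Fin.reduceFinMk, Fin.isValue, PiLp.single_apply,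
              show (0 : Fin 3) ≠ 2 by decide, ↓reduceIte, mul_zero,
              show (1 : Fin 3) ≠ 2 by decide, add_zero, zero_mul, abs_zero]
            positivity
        calc _ ≤ |2 * (x 0 * (EuclideanSpace.single i (1 : ℝ) : EuclideanSpace ℝ (Fin 3)) 0 +
              x 1 * (EuclideanSpace.single i (1 : ℝ) : EuclideanSpace ℝ (Fin 3)) 1) * g x| +
              |cylRadius x ^ 2 * fderiv ℝ g x (EuclideanSpace.single i 1)| := abs_add_le _ _
          _ ≤ 2 * Cg + Cg := add_le_add hA (hgD i x)
      have hDφc : Continuous fun x => fderiv ℝ φ x (EuclideanSpace.single i 1) :=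
        (hφ1.continuous_fderiv one_ne_zero).clm_apply continuous_const
      have := hβL1.bdd_mul hDφc.aestronglyMeasurable (ae_of_all _ fun x => by
        rw [Real.norm_eq_abs]; exact hDφi x)
      exact this
    · -- `φ ∂ᵢ(β∘G) = φ β'(G) ∂ᵢG ∈ L¹`
      have e : (fun x => φ x * fderiv ℝ (fun y => β (G y)) x (EuclideanSpace.single i 1)) =
          fun x => φ x * (deriv β (G x) * fderiv ℝ G x (EuclideanSpace.single i 1)) := by
        funext x; rw [hchain]
      rw [e]
      exact (hβ'L2.integrable_mul (h1 i)).bdd_mul hφc.aestronglyMeasurable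
        (ae_of_all _ fun x => by rw [Real.norm_eq_abs]; exact hφb x)
  have hT : ∫ x, φ x * (deriv β (G x) * fderiv ℝ G x (b x)) =
      -∫ x, fderiv ℝ φ x (b x) * β (G x) := by
    rw [← hT']
    refine integral_congr_ae (Eventually.of_forall fun x => ?_)
    simp only [hchain]
  -- (D) diffusion
  have hdivW : ∀ x, VectorCalculus.divergence (fun y => (cylRadius y ^ 2) • gradient G y) x =
      cylRadius x ^ 2 * ((Δ G) x + 2 * radDerivQuot G x) := fun x =>
    (cylRadius_sq_mul_laplacian_add_eq_divergence hG hax x).symm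
  have hgradG : ContDiff ℝ 1 (gradient G) :=
    (InnerProductSpace.toDual ℝ (EuclideanSpace ℝ (Fin 3))).symm.contDiff.comp
      (hG.fderiv_right (m := 1) le_rfl)
  have hgradg : ContDiff ℝ 1 (gradient g) :=
    (InnerProductSpace.toDual ℝ (EuclideanSpace ℝ (Fin 3))).symm.contDiff.comp
      (hg.fderiv_right (m := 1) le_rfl)
  have hW : ContDiff ℝ 1 fun y => (cylRadius y ^ 2) • gradient G y := hr2.smul hgradG
  have hV : ContDiff ℝ 1 fun y => (cylRadius y ^ 2) • gradient g y := hr2.smul hgradg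
  -- Laplacian data in `L²`
  have hΔ : MemLp (fun x => (Δ G) x) 2 volume := by
    have e : (fun x => (Δ G) x) = fun x =>
        fderiv ℝ (fun y => fderiv ℝ G y (EuclideanSpace.single 0 1)) x (EuclideanSpace.single 0 1) +
        fderiv ℝ (fun y => fderiv ℝ G y (EuclideanSpace.single 1 1)) x (EuclideanSpace.single 1 1) +
        fderiv ℝ (fun y => fderiv ℝ G y (EuclideanSpace.single 2 1)) x (EuclideanSpace.single 2 1) := by
      funext x
      rw [laplacian_eq_sum_fderiv_fderiv (EuclideanSpace.basisFun (Fin 3) ℝ) hG x]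
      simp only [EuclideanSpace.basisFun_apply, Fin.sum_univ_three]
    rw [e]
    exact ((h2 0).add (h2 1)).add (h2 2)
  -- abbreviations for the two bilinear integrands
  set S : EuclideanSpace ℝ (Fin 3) → ℝ := fun x =>
    fderiv ℝ G x (EuclideanSpace.single 0 1) * (cylRadius x ^ 2 * fderiv ℝ g x (EuclideanSpace.single 0 1)) +
    fderiv ℝ G x (EuclideanSpace.single 1 1) * (cylRadius x ^ 2 * fderiv ℝ g x (EuclideanSpace.single 1 1)) +
    fderiv ℝ G x (EuclideanSpace.single 2 1) * (cylRadius x ^ 2 * fderiv ℝ g x (EuclideanSpace.single 2 1))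
    with hSdef
  set Q : EuclideanSpace ℝ (Fin 3) → ℝ := fun x =>
    (cylRadius x ^ 2 * g x) * (deriv (deriv β) (G x) *
      (fderiv ℝ G x (EuclideanSpace.single 0 1) * fderiv ℝ G x (EuclideanSpace.single 0 1) +
       fderiv ℝ G x (EuclideanSpace.single 1 1) * fderiv ℝ G x (EuclideanSpace.single 1 1) +
       fderiv ℝ G x (EuclideanSpace.single 2 1) * fderiv ℝ G x (EuclideanSpace.single 2 1)))
    with hQdef
  have iS : Integrable fun x => deriv β (G x) * S x := by
    have hi : ∀ i : Fin 3, Integrable fun x => deriv β (G x) *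
        (fderiv ℝ G x (EuclideanSpace.single i 1) *
          (cylRadius x ^ 2 * fderiv ℝ g x (EuclideanSpace.single i 1))) := by
      intro i
      have e : (fun x => deriv β (G x) * (fderiv ℝ G x (EuclideanSpace.single i 1) *
          (cylRadius x ^ 2 * fderiv ℝ g x (EuclideanSpace.single i 1)))) = fun x =>
          (cylRadius x ^ 2 * fderiv ℝ g x (EuclideanSpace.single i 1)) *
            (deriv β (G x) * fderiv ℝ G x (EuclideanSpace.single i 1)) := by
        funext x; ring
      rw [e]
      exact (hβ'L2.integrable_mul (h1 i)).bdd_mul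
        (((hg1.continuous_fderiv one_ne_zero).clm_apply continuous_const |>
          (continuous_cylRadius.pow 2).mul)).aestronglyMeasurable
        (ae_of_all _ fun x => by rw [Real.norm_eq_abs]; exact hgD i x)
    have := ((hi 0).add (hi 1)).add (hi 2)
    refine this.congr (Eventually.of_forall fun x => ?_)
    simp only [hSdef, Pi.add_apply]
    ring
  have iQ : Integrable Q := by
    have hi : ∀ i : Fin 3, Integrable fun x => (cylRadius x ^ 2 * g x) * (deriv (deriv β) (G x) *
        (fderiv ℝ G x (EuclideanSpace.single i 1) * fderiv ℝ G x (EuclideanSpace.single i 1))) := by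
      intro i
      have hgg : Integrable fun x => fderiv ℝ G x (EuclideanSpace.single i 1) *
          fderiv ℝ G x (EuclideanSpace.single i 1) := (h1 i).integrable_mul (h1 i)
      have hb1 : Integrable fun x => deriv (deriv β) (G x) *
          (fderiv ℝ G x (EuclideanSpace.single i 1) * fderiv ℝ G x (EuclideanSpace.single i 1)) :=
        hgg.bdd_mul ((continuous_deriv_deriv_of_contDiff_two' hβ).comp hG.continuous).aestronglyMeasurable
          (ae_of_all _ fun x => by rw [Real.norm_eq_abs]; exact hK (G x))
      exact hb1.bdd_mul hφc.aestronglyMeasurable (ae_of_all _ fun x => by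
        rw [Real.norm_eq_abs]; exact hφb x)
    have := ((hi 0).add (hi 1)).add (hi 2)
    refine this.congr (Eventually.of_forall fun x => ?_)
    simp only [hQdef, Pi.add_apply]
    ring
  have hQnn : ∀ x, 0 ≤ Q x := fun x => by
    simp only [hQdef]
    refine mul_nonneg (mul_nonneg (sq_nonneg _) (hg0 x)) (mul_nonneg (hnn (G x)) ?_)
    nlinarith [mul_self_nonneg (fderiv ℝ G x (EuclideanSpace.single 0 1)),
      mul_self_nonneg (fderiv ℝ G x (EuclideanSpace.single 1 1)),
      mul_self_nonneg (fderiv ℝ G x (EuclideanSpace.single 2 1))]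
  -- IBP1: `θ₁ = g β'(G)`, `u₁ = r² ∇G`
  set θ₁ : EuclideanSpace ℝ (Fin 3) → ℝ := fun x => g x * deriv β (G x) with hθ₁def
  have hθ₁ : ContDiff ℝ 1 θ₁ := hg1.mul hβ'G
  have hpair1 : ∀ x, ⟪(cylRadius x ^ 2) • gradient G x, gradient θ₁ x⟫ =
      deriv β (G x) * S x + Q x := by
    intro x
    rw [real_inner_smul_left, inner_eq_sum₃']
    simp only [gradient_apply_eq_fderiv_single₃']
    have hθd : ∀ i : Fin 3, fderiv ℝ θ₁ x (EuclideanSpace.single i 1) =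
        fderiv ℝ g x (EuclideanSpace.single i 1) * deriv β (G x) +
        g x * (deriv (deriv β) (G x) * fderiv ℝ G x (EuclideanSpace.single i 1)) := by
      intro i
      rw [hθ₁def, fderiv_fun_mul (hgd x) ((hβ'G.differentiable one_ne_zero) x)]
      simp only [_root_.add_apply, _root_.smul_apply, smul_eq_mul, hchain']
      ring
    rw [hθd 0, hθd 1, hθd 2]
    simp only [hSdef, hQdef]
    ring
  have ibp1 := integral_mul_divergence_add_eq_zero_of_integrable (θ := θ₁)
    (u := fun y => (cylRadius y ^ 2) • gradient G y) hθ₁ hW ?_ ?_ ?_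
  rotate_left
  · -- `θ₁ • (r²∇G) ∈ L¹`
    have hb0 : Integrable fun x => |cylRadius x ^ 2 * g x| * (|deriv β (G x)| *
        (|fderiv ℝ G x (EuclideanSpace.single 0 1)| + |fderiv ℝ G x (EuclideanSpace.single 1 1)| +
          |fderiv ℝ G x (EuclideanSpace.single 2 1)|)) := by
      have h3 := ((hβ'L2.norm.integrable_mul (h1 0).norm).add (hβ'L2.norm.integrable_mul (h1 1).norm)).add
        (hβ'L2.norm.integrable_mul (h1 2).norm)
      have hmφ : AEStronglyMeasurable (fun x => |cylRadius x ^ 2 * g x|) volume :=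
        (((continuous_cylRadius.pow 2).mul hg1.continuous).abs).aestronglyMeasurable
      have h4 := h3.bdd_mul (c := Cg) hmφ
        (ae_of_all _ fun x => by rw [Real.norm_eq_abs, abs_abs]; exact hgr x)
      refine h4.congr (Eventually.of_forall fun x => ?_)
      simp only [Pi.add_apply, Pi.mul_apply, Real.norm_eq_abs]
      ring
    refine hb0.mono' ((hθ₁.continuous.smul hW.continuous).aestronglyMeasurable)
      (Eventually.of_forall fun x => ?_)
    rw [norm_smul, norm_smul, Real.norm_eq_abs, Real.norm_eq_abs, hθ₁def]
    simp only
    rw [abs_mul, show |g x| * |deriv β (G x)| * (|cylRadius x ^ 2| * ‖gradient G x‖) =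
      (|cylRadius x ^ 2| * |g x|) * (|deriv β (G x)| * ‖gradient G x‖) by ring, ← abs_mul]
    gcongr
    refine (norm_le_abs_add' _).trans (le_of_eq ?_)
    simp only [gradient_apply_eq_fderiv_single₃']
  · -- `θ₁ div(r²∇G) = g β'(G) r² (ΔG + 2 rdq G) ∈ L¹`
    have e : (fun x => θ₁ x * VectorCalculus.divergence (fun y => (cylRadius y ^ 2) • gradient G y) x) =
        fun x => (cylRadius x ^ 2 * g x) * (deriv β (G x) * ((Δ G) x + 2 * radDerivQuot G x)) := by
      funext x; rw [hdivW, hθ₁def]; ring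
    rw [e]
    exact (hβ'L2.integrable_mul (hΔ.add (hq.const_mul 2))).bdd_mul hφc.aestronglyMeasurable
      (ae_of_all _ fun x => by rw [Real.norm_eq_abs]; exact hφb x)
  · -- the pairing
    simp_rw [hpair1]
    exact iS.add iQ
  -- IBP2: `θ₂ = β∘G`, `u₂ = r² ∇g`
  have hpair2 : ∀ x, ⟪(cylRadius x ^ 2) • gradient g x, gradient (fun y => β (G y)) x⟫ =
      deriv β (G x) * S x := by
    intro x
    rw [real_inner_smul_left, inner_eq_sum₃']
    simp only [gradient_apply_eq_fderiv_single₃', hchain]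
    simp only [hSdef]
    ring
  have ibp2 := integral_mul_divergence_add_eq_zero_of_integrable (θ := fun y => β (G y))
    (u := fun y => (cylRadius y ^ 2) • gradient g y) hβG hV ?_ ?_ ?_
  rotate_left
  · -- `β(G) • (r²∇g) ∈ L¹`
    have hb0 : Integrable fun x => |β (G x)| *
        (|cylRadius x ^ 2 * fderiv ℝ g x (EuclideanSpace.single 0 1)| +
          |cylRadius x ^ 2 * fderiv ℝ g x (EuclideanSpace.single 1 1)| +
          |cylRadius x ^ 2 * fderiv ℝ g x (EuclideanSpace.single 2 1)|) := by
      have hc : ∀ i : Fin 3, Continuous fun x => |cylRadius x ^ 2 *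
          fderiv ℝ g x (EuclideanSpace.single i 1)| := fun i =>
        ((continuous_cylRadius.pow 2).mul
          ((hg1.continuous_fderiv one_ne_zero).clm_apply continuous_const)).abs
      have hc3 : Continuous fun x => |cylRadius x ^ 2 * fderiv ℝ g x (EuclideanSpace.single 0 1)| +
          |cylRadius x ^ 2 * fderiv ℝ g x (EuclideanSpace.single 1 1)| +
          |cylRadius x ^ 2 * fderiv ℝ g x (EuclideanSpace.single 2 1)| := ((hc 0).add (hc 1)).add (hc 2)
      have h4 := hβL1.norm.bdd_mul (c := Cg + Cg + Cg) hc3.aestronglyMeasurable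
        (ae_of_all _ fun x => by
          rw [Real.norm_eq_abs, abs_of_nonneg (by positivity)]
          linarith [hgD 0 x, hgD 1 x, hgD 2 x])
      refine h4.congr (Eventually.of_forall fun x => ?_)
      simp only [Real.norm_eq_abs]
      ring
    refine hb0.mono' ((hβG.continuous.smul hV.continuous).aestronglyMeasurable)
      (Eventually.of_forall fun x => ?_)
    rw [norm_smul, Real.norm_eq_abs]
    gcongr
    rw [norm_smul, Real.norm_eq_abs]
    calc |cylRadius x ^ 2| * ‖gradient g x‖
        ≤ |cylRadius x ^ 2| * (|gradient g x 0| + |gradient g x 1| + |gradient g x 2|) := by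
          gcongr; exact norm_le_abs_add' _
      _ = _ := by simp only [gradient_apply_eq_fderiv_single₃', abs_mul]; ring
  · -- `β(G) div(r²∇g) ∈ L¹`
    have hdc : Continuous fun x =>
        VectorCalculus.divergence (fun y => (cylRadius y ^ 2) • gradient g y) x :=
      continuous_divergence (hV.continuous_fderiv one_ne_zero)
    have := hβL1.bdd_mul hdc.aestronglyMeasurable (ae_of_all _ fun x => by
      rw [Real.norm_eq_abs]; exact hgdiv x)
    exact this.congr (Eventually.of_forall fun x => mul_comm _ _)
  · simp_rw [hpair2]; exact iS
  -- the diffusion term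
  have hdivc : Continuous fun x =>
      VectorCalculus.divergence (fun y => (cylRadius y ^ 2) • gradient g y) x :=
    continuous_divergence (hV.continuous_fderiv one_ne_zero)
  have iΔ : Integrable fun x => φ x * (deriv β (G x) * ((Δ G) x + 2 * radDerivQuot G x)) :=
    (hβ'L2.integrable_mul (hΔ.add (hq.const_mul 2))).bdd_mul hφc.aestronglyMeasurable
      (ae_of_all _ fun x => by rw [Real.norm_eq_abs]; exact hφb x)
  have hD' : ∫ x, φ x * (deriv β (G x) * ((Δ G) x + 2 * radDerivQuot G x)) ≤
      ∫ x, β (G x) * VectorCalculus.divergence (fun y => (cylRadius y ^ 2) • gradient g y) x := by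
    have e1 : ∫ x, φ x * (deriv β (G x) * ((Δ G) x + 2 * radDerivQuot G x)) =
        ∫ x, θ₁ x * VectorCalculus.divergence (fun y => (cylRadius y ^ 2) • gradient G y) x :=
      integral_congr_ae (Eventually.of_forall fun x => by
        simp only [hφdef, hθ₁def]; rw [hdivW]; ring)
    have e2 : ∫ x, ⟪(cylRadius x ^ 2) • gradient G x, gradient θ₁ x⟫ =
        (∫ x, deriv β (G x) * S x) + ∫ x, Q x := by
      rw [← integral_add iS iQ]
      exact integral_congr_ae (Eventually.of_forall fun x => hpair1 x)
    have e3 : ∫ x, ⟪(cylRadius x ^ 2) • gradient g x, gradient (fun y => β (G y)) x⟫ =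
        ∫ x, deriv β (G x) * S x :=
      integral_congr_ae (Eventually.of_forall fun x => hpair2 x)
    have hQ : 0 ≤ ∫ x, Q x := integral_nonneg hQnn
    rw [e1]
    rw [e2] at ibp1
    rw [e3] at ibp2
    linarith
  -- the transport integrand
  have iTr : Integrable fun x => φ x * (deriv β (G x) * fderiv ℝ G x (b x)) := by
    have e : (fun x => φ x * (deriv β (G x) * fderiv ℝ G x (b x))) = fun x =>
        b x 0 * (φ x * (deriv β (G x) * fderiv ℝ G x (EuclideanSpace.single 0 1))) +
        b x 1 * (φ x * (deriv β (G x) * fderiv ℝ G x (EuclideanSpace.single 1 1))) +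
        b x 2 * (φ x * (deriv β (G x) * fderiv ℝ G x (EuclideanSpace.single 2 1))) := by
      funext x
      rw [clm_apply_eq_sum₃ (fderiv ℝ G x) (b x)]
      ring
    rw [e]
    have hbd : ∀ j : Fin 3, Integrable fun x => b x j *
        (φ x * (deriv β (G x) * fderiv ℝ G x (EuclideanSpace.single j 1))) := fun j =>
      (((hβ'L2.integrable_mul (h1 j)).bdd_mul hφc.aestronglyMeasurable
        (ae_of_all _ fun x => by rw [Real.norm_eq_abs]; exact hφb x))).bdd_mul
        ((contDiff_apply_coord_vec3 hb j).continuous.aestronglyMeasurable)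
        (ae_of_all _ fun x => ((Real.norm_eq_abs _).le.trans
          ((Real.norm_eq_abs _).symm.le.trans (PiLp.norm_apply_le (b x) j))).trans (hbB x))
    exact ((hbd 0).add (hbd 1)).add (hbd 2)
  -- integrate `φ β'(G) ×` the equation
  calc ∫ x, cylRadius x ^ 2 * g x * deriv β (G x) * G' x
      = ∫ x, (ν * (φ x * (deriv β (G x) * ((Δ G) x + 2 * radDerivQuot G x))) -
          φ x * (deriv β (G x) * fderiv ℝ G x (b x))) :=
        integral_congr_ae (Eventually.of_forall fun x => by
          show cylRadius x ^ 2 * g x * deriv β (G x) * G' x = _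
          have e : G' x = ν * ((Δ G) x + 2 * radDerivQuot G x) - fderiv ℝ G x (b x) := by
            linarith [heq x]
          rw [e, hφdef]
          ring)
    _ = ν * (∫ x, φ x * (deriv β (G x) * ((Δ G) x + 2 * radDerivQuot G x))) -
          ∫ x, φ x * (deriv β (G x) * fderiv ℝ G x (b x)) := by
        rw [integral_sub (iΔ.const_mul ν) iTr, integral_const_mul]
    _ = ν * (∫ x, φ x * (deriv β (G x) * ((Δ G) x + 2 * radDerivQuot G x))) +
          ∫ x, β (G x) * fderiv ℝ φ x (b x) := by
        rw [hT, sub_neg_eq_add]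
        congr 1
        exact integral_congr_ae (Eventually.of_forall fun x => by ring)
    _ ≤ ν * (∫ x, β (G x) * VectorCalculus.divergence (fun y => (cylRadius y ^ 2) • gradient g y) x) +
          ∫ x, β (G x) * fderiv ℝ φ x (b x) := by
        gcongr
    _ = _ := by rw [hφdef]; ring

end Slice

/-! ### The slice inequality in Tao's class -/

section TaoClass

variable {T ν : ℝ} {u₀ : EuclideanSpace ℝ (Fin 3) → EuclideanSpace ℝ (Fin 3)}
  {v : ℝ → EuclideanSpace ℝ (Fin 3) → EuclideanSpace ℝ (Fin 3)}
  {q : ℝ → EuclideanSpace ℝ (Fin 3) → ℝ} {β : ℝ → ℝ} {K Cg : ℝ}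
  {g : EuclideanSpace ℝ (Fin 3) → ℝ}

/-- Without swirl the angular velocity quotient `u^θ/r` vanishes identically (private copy of the
lemma of `AxisymNoSwirlCoSignedFlux`). [folklore] -/
private theorem angVelQuot_eq_zero_of_hasNoSwirl'' {u : EuclideanSpace ℝ (Fin 3) → EuclideanSpace ℝ (Fin 3)}
    (hsw : HasNoSwirl u) : angVelQuot u = 0 := by
  have h0 : swirl u = fun _ => 0 := funext fun x => hsw x
  funext x
  simp only [angVelQuot, h0, Pi.zero_apply]
  have h1 : radDerivQuot (fun _ : EuclideanSpace ℝ (Fin 3) => (0 : ℝ)) = fun _ => 0 := by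
    funext y
    simp [radDerivQuot, hadamardQuotFst]
  simp [radQuot, h1]

/-- **The weighted slice inequality in Tao's class** (Gallay–Šverák 2015, Lemma 5.1 against the
weight `r²g` of Lemma 6.4). Let `(v, q)` be a Tao-class solution on `[0, T]` (`0 < ν`, `0 < T`)
from an axisymmetric swirl-free datum, `Ω(t) = angVortQuot (v t) = ω_θ/r`,
`Ω'(t) = angVortQuot (∂ₜv t)`; let `β ∈ C²` with `β(0) = β'(0) = 0`, `0 ≤ β'' ≤ K`, and let
`g ∈ C²`, `g ≥ 0`, be a weight with `|r²g|, |x₀g|, |x₁g|, |r²∂ᵢg|, |div(r²∇g)| ≤ C_g`. Then for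
every `t ∈ [0, T]`:
`∫ r²g β'(Ω(t)) Ω'(t) dx ≤ ∫ β(Ω(t)) D(r²g)[v(t)] dx + ν ∫ β(Ω(t)) div(r²∇g) dx`.
[cite: GallaySverak2016, §5 Lemma 5.1 proof and §6 Lemma 6.4 proof (arXiv pp. 16, 19)] -/
theorem IsTaoSolutionOn.integral_weight_mul_deriv_comp_mul_angVortQuot_deriv_le
    (h : IsTaoSolutionOn T ν u₀ v q) (hT : 0 < T) (hν : 0 < ν) (h0 : IsAxisymmetric u₀)
    (h0' : HasNoSwirl u₀)
    (hβ : ContDiff ℝ 2 β) (h00 : β 0 = 0) (hβ0 : deriv β 0 = 0)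
    (hnn : ∀ w, 0 ≤ deriv (deriv β) w) (hK : ∀ w, |deriv (deriv β) w| ≤ K)
    (hg : ContDiff ℝ 2 g) (hg0 : ∀ x, 0 ≤ g x)
    (hgr : ∀ x, |cylRadius x ^ 2 * g x| ≤ Cg)
    (hgx0 : ∀ x, |x 0 * g x| ≤ Cg) (hgx1 : ∀ x, |x 1 * g x| ≤ Cg)
    (hgD : ∀ (i : Fin 3) x, |cylRadius x ^ 2 * fderiv ℝ g x (EuclideanSpace.single i 1)| ≤ Cg)
    (hgdiv : ∀ x, |VectorCalculus.divergence (fun y => (cylRadius y ^ 2) • gradient g y) x| ≤ Cg)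
    {t : ℝ} (ht : t ∈ Icc 0 T) :
    ∫ x, cylRadius x ^ 2 * g x * deriv β (angVortQuot (v t) x) *
        angVortQuot (timeDerivWithin (Icc 0 T) v t) x ≤
      (∫ x, β (angVortQuot (v t) x) * fderiv ℝ (fun y => cylRadius y ^ 2 * g y) x (v t x)) +
      ν * ∫ x, β (angVortQuot (v t) x) *
        VectorCalculus.divergence (fun y => (cylRadius y ^ 2) • gradient g y) x := by
  have hU : UniqueDiffOn ℝ (Icc 0 T) := uniqueDiffOn_Icc hT
  have hcl := Icc_subset_closure_interior_Icc' hT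
  have hax : ∀ s ∈ Icc 0 T, IsAxisymmetric (v s) := h.isAxisymmetric hν hT h0
  have hsw : HasNoSwirl (v t) := h.hasNoSwirl hν hT h0 h0' t ht
  have hvs := h.classical.contDiff_velocity ht
  have hv1 : ContDiff ℝ 1 (v t) := hvs.of_le (by norm_cast)
  have hv3 : ContDiff ℝ 3 (v t) := hvs.of_le (by norm_cast)
  have hΩ2 : ContDiff ℝ 2 (angVortQuot (v t)) :=
    contDiff_angVortQuot (n := 2) (by exact_mod_cast hvs.of_le (by norm_cast))
  have hΩax : IsAxisymmetricScalar (angVortQuot (v t)) := (hax t ht).isAxisymmetricScalar_angVortQuot hv3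
  obtain ⟨m0, m1, m2, mq⟩ := h.memLp_angVortQuot_data hax ht
  obtain ⟨B, -, hB⟩ := h.exists_bound_velocity
  obtain ⟨B', -, hB'⟩ := h.exists_bound_fderiv_velocity
  have heq : ∀ x, angVortQuot (timeDerivWithin (Icc 0 T) v t) x +
      fderiv ℝ (angVortQuot (v t)) x (v t x) =
      ν * ((Δ (angVortQuot (v t))) x + 2 * radDerivQuot (angVortQuot (v t)) x) := by
    intro x
    have e := h.classical.angVortQuot_eq hU hcl hax ht x
    rw [angVelQuot_eq_zero_of_hasNoSwirl'' hsw] at e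
    simp only [Pi.zero_apply] at e
    linarith
  exact integral_weight_mul_deriv_comp_mul_le_of_drift_laplacian hβ h00 hβ0 hnn hK hΩ2 hΩax hν.le m0
    m1 m2 mq hv1 (h.classical.divFree t ht) (hB t ht) (hB' t ht) heq hg hg0 hgr hgx0 hgx1 hgD hgdiv

end TaoClass

end Literature.Analysis.FluidPDE

end
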